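import Literature.AlgebraicGeometry.Motives.FaltingsFinitenessIDimZeroProofs
import Summits.Langlands.Langlands.Theses.PhantomRMYoshida
import HarnessLib

/-!
# Route PhantomRMYoshida — FaltingsFinitenessI (item stmt-Langlands-15084): the dimension-`0` case, unconditionally

The named-fact gate `FaltingsFinitenessI` of route `PhantomRMYoshida` (item stmt-Langlands-15084) is
Faltings' **Finiteness I over `ℚ`**,

  `∀ A : AbelianVariety ℚ, ∃ (n : ℕ) (C : Fin n → AbelianVariety ℚ),
     ∀ B : AbelianVariety ℚ, IsIsogenous B A → ∃ i, Nonempty (B ≅ C i)`,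

verbatim the Literature named fact `AbelianVariety.finite_isoClasses_isogenous A` at `K = ℚ`
(sibling files `PhantomRMYoshidaFaltingsFinitenessI.lean`, `…TateModule.lean`), whose discharge —
Faltings 1983, §6 with Zarhin's trick; Milne, *Abelian Varieties* (2008), IV Thm. 1.1 — is not in
the tree.  This file records the one fragment of the item that IS a theorem of the tree today: its
instance at abelian varieties of dimension `0`, where the isogeny class is the single isomorphism
class of the zero abelian variety
(`Literature/AlgebraicGeometry/Motives/FaltingsFinitenessIDimZeroProofs.lean`:
`exists_isoClasses_isogenous_of_dim_eq_zero`, from `hom_eq_zero_of_dim_eq_zero` and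
`dim_eq_of_isIsogenous_holds`).  It does not close the item (which quantifies over all `A`); it is
the base case that any discharge of the fact dispatches separately from the height arguments:

* `faltingsFinitenessI_of_dim_eq_zero` — the item's body at every `A` with `dim A = 0`;
* `finite_isoClasses_isogenous_rat_of_dim_eq_zero` — the Literature fact over `ℚ` at such `A`;
* `faltingsFinitenessI_iff_forall_dim_pos` / `faltingsFinitenessI_of_forall_dim_pos` — the route
  decl is equivalent to (follows from) its restriction to `0 < dim A`: what remains of the item is
  exactly Finiteness I over `ℚ` in positive dimension.

Pure-proof file, no definitions.
-/

set_option linter.dupNamespace false -- as in the sibling Theorems files: `Summit.Langlands.Langlands` is the mandated namespace (summit = sub-problem)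

noncomputable section

open CategoryTheory
open Literature.AlgebraicGeometry.Motives
open Literature.AlgebraicGeometry.Motives.AbelianVariety

namespace Summit.Langlands.Langlands.Theorems.PhantomRMYoshida

/-- **Item stmt-Langlands-15084 at dimension `0`, unconditionally**: for every abelian variety `A`
over `ℚ` with `dim A = 0` there is a finite family (`n = 1`, `C₀ = A`) such that every `B`
admitting an isogeny `B → A` is isomorphic in `AbelianVariety ℚ` to some `C i` — the body of the
route decl `FaltingsFinitenessI` (Faltings' Finiteness I; Milne, *Abelian Varieties* (2008), IV
Thm. 1.1) at such `A`, by `exists_isoClasses_isogenous_of_dim_eq_zero` (an isogeny preserves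
dimension and `0`-dimensional abelian varieties are isomorphic via the zero homomorphisms). -/
theorem faltingsFinitenessI_of_dim_eq_zero (A : AbelianVariety ℚ) (hA : A.dim = 0) :
    ∃ (n : ℕ) (C : Fin n → AbelianVariety ℚ),
      ∀ B : AbelianVariety ℚ, IsIsogenous B A → ∃ i, Nonempty (B ≅ C i) :=
  exists_isoClasses_isogenous_of_dim_eq_zero A hA

/-- **The Literature fact over `ℚ` at dimension `0`**: `AbelianVariety.finite_isoClasses_isogenous A`
holds for every `A : AbelianVariety ℚ` with `dim A = 0` (`finite_isoClasses_isogenous_of_dim_eq_zero`),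
i.e. the right-hand side of `faltingsFinitenessI_iff` restricted to dimension `0`; what remains of
the item is exactly the fact at the abelian varieties of positive dimension. -/
theorem finite_isoClasses_isogenous_rat_of_dim_eq_zero (A : AbelianVariety ℚ) (hA : A.dim = 0) :
    finite_isoClasses_isogenous A :=
  finite_isoClasses_isogenous_of_dim_eq_zero A hA

/-- **What remains of the item is exactly the positive-dimensional case**: the route decl
`FaltingsFinitenessI` (item stmt-Langlands-15084, Finiteness I over `ℚ` for every `A`) is
equivalent to its restriction to abelian varieties of positive dimension, the dimension-`0` case
being the theorem `faltingsFinitenessI_of_dim_eq_zero` (case split on `A.dim = 0 ∨ 0 < A.dim`).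
So a discharge of Faltings' theorem for `dim A ≥ 1` — the range in which the height arguments of
Faltings 1983, §§3–6 operate — closes the item verbatim. -/
theorem faltingsFinitenessI_iff_forall_dim_pos :
    Summit.Langlands.Langlands.Theses.PhantomRMYoshida.FaltingsFinitenessI ↔
      ∀ A : AbelianVariety ℚ, 0 < A.dim → ∃ (n : ℕ) (C : Fin n → AbelianVariety ℚ),
        ∀ B : AbelianVariety ℚ, IsIsogenous B A → ∃ i, Nonempty (B ≅ C i) := by
  unfold Summit.Langlands.Langlands.Theses.PhantomRMYoshida.FaltingsFinitenessI
  refine ⟨fun h A _ ↦ h A, fun h A ↦ ?_⟩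
  rcases Nat.eq_zero_or_pos A.dim with hA | hA
  · exact faltingsFinitenessI_of_dim_eq_zero A hA
  · exact h A hA

/-- **Conditional closer from the positive-dimensional fact**: if Finiteness I over `ℚ` holds for
every abelian variety of positive dimension, the route decl `FaltingsFinitenessI` follows
(`faltingsFinitenessI_iff_forall_dim_pos`, reverse direction). -/
theorem faltingsFinitenessI_of_forall_dim_pos
    (h : ∀ A : AbelianVariety ℚ, 0 < A.dim → ∃ (n : ℕ) (C : Fin n → AbelianVariety ℚ),
      ∀ B : AbelianVariety ℚ, IsIsogenous B A → ∃ i, Nonempty (B ≅ C i)) :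
    Summit.Langlands.Langlands.Theses.PhantomRMYoshida.FaltingsFinitenessI :=
  faltingsFinitenessI_iff_forall_dim_pos.2 h

end Summit.Langlands.Langlands.Theorems.PhantomRMYoshida

end
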